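import Summits.KontsevichZagierPeriods.KontsevichZagierPeriods.Theorems.FermatIsogenyDeepWordSectorP10
/-! # `FermatIsogenyDeepWordSectorP11` — part 11/11 of the mechanical ≤400-line split of `DeepWordSector.lean` (sha256 5e8cd5c1c920648a…)
Source: decomp-kz lens-5 g22 DeepWordSector.lean v10 @5e8cd5c1 (the deep Beta-word sector node: bridge S ⟺ BetaWordTower ∧ WordSectorComplete, finite boxes, box ladder, shadow arithmetic, Chudnovsky levels; critic CLEARED g6-2/3/4/11/13/16/19); --supports stmt-KontsevichZagierPeriods-3898.
Split by census-1 g10 `gen/splitlean.py`: scopes re-opened with their `open`/`variable`/`set_option` context; mathematics and declaration order unchanged. -/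

namespace Summit.KontsevichZagierPeriods.FermatIsogeny.DeepTargets
open Literature.NumberTheory.Transcendental MeasureTheory
open Summit.KontsevichZagierPeriods.KontsevichZagierPeriods.Theses.FermatIsogeny (BetaLinearSector BetaProductSector FermatSectorComplete)
section ChudnovskyLevels

/-- **The level-2 box is its same-type chains — second proof of rung (k,2) through the Γ-machine.** [this node] -/
theorem betaWordSectorLevel_two_iff_sameType (k : ℕ) : BetaWordSectorLevel k 2 ↔ BoxChain k 2 (SameType 2) :=
  betaWordSectorLevel_iff_of_rohrlichHodgeAt (by norm_num) rohrlichHodgeAt_two k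

/-- **The level-3 box of every `k`-letter sector is its same-type chains, modulo Chudnovsky.** [this node] -/
theorem betaWordSectorLevel_three_iff (h : GammaThirdPiIndep) (k : ℕ) :
    BetaWordSectorLevel k 3 ↔ BoxChain k 3 (SameType 3) :=
  betaWordSectorLevel_iff_of_rohrlichHodgeAt (by norm_num) (rohrlichHodgeAt_three_of h) k

/-- **The level-4 box of every `k`-letter sector is its same-type chains, modulo Chudnovsky.** [this node] -/
theorem betaWordSectorLevel_four_iff (h : GammaQuarterPiIndep) (k : ℕ) :
    BetaWordSectorLevel k 4 ↔ BoxChain k 4 (SameType 4) :=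
  betaWordSectorLevel_iff_of_rohrlichHodgeAt (by norm_num) (rohrlichHodgeAt_four_of h) k

/-- **The level-6 box of every `k`-letter sector is its same-type chains, modulo Chudnovsky.** [this node] -/
theorem betaWordSectorLevel_six_iff (h : GammaThirdPiIndep) (k : ℕ) :
    BetaWordSectorLevel k 6 ↔ BoxChain k 6 (SameType 6) :=
  betaWordSectorLevel_iff_of_rohrlichHodgeAt (by norm_num) (rohrlichHodgeAt_six_of h) k

end ChudnovskyLevels

section ChudnovskyFaithful

/-!
### v10 (decomp-kz · lens-5 · g22, addendum 3) — Chudnovsky's theorem typed FAITHFULLY and the derivation to what the levels use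

The critic (STATUS l.1329/1338) asked for Chudnovsky's Theorem 14 as ONE faithful statement rather than the consequence
`GammaThirdPiIndep` / `GammaQuarterPiIndep`.  Here: `ChudnovskyGammaThird := AlgebraicIndependent ℚ ![Γ(⅓), π]`,
`ChudnovskyGammaQuarter := AlgebraicIndependent ℚ ![Γ(¼), π]` — literally the printed theorem
(cite Waldschmidt2006, Theorem 14; G. V. Chudnovsky, Algebraic independence of constants connected with the exponential
and the elliptic functions, Dokl. Akad. Nauk Ukrain. SSR Ser. A 8 (1976) 698–701) — still HYPOTHESES here (never facts; the
tree has no proof), plus the general PROVED lemma `transcendental_zpow_mul_zpow_of_algebraicIndependent`: algebraic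
independence of `(x, y)` ⟹ every non-trivial monomial `x^a y^b`, `(a, b) ∈ ℤ² ∖ 0`, is transcendental; hence
`gammaThirdPiIndep_of_chudnovsky`, `gammaQuarterPiIndep_of_chudnovsky` and the level theorems restated on the faithful
hypotheses.  A typer can move the two `def`s verbatim to `Literature/NumberTheory/Transcendental/` as cite-tagged named facts.
-/

/-- Over a domain `R`, the inverse of a non-zero `R`-algebraic real is `R`-algebraic. [standard] -/
theorem isAlgebraic_inv_of_isAlgebraic {R : Type*} [CommRing R] [NoZeroDivisors R] [Algebra R ℝ]
    {z : ℝ} (hz : z ≠ 0) (h : IsAlgebraic R z) : IsAlgebraic R z⁻¹ := by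
  have := h.nontrivial
  have h1 : IsAlgebraic R (z * z⁻¹) := by
    rw [mul_inv_cancel₀ hz]; exact isAlgebraic_one
  exact IsAlgebraic.of_mul (mem_nonZeroDivisors_of_ne_zero hz) h h1

/-- Over a domain `R`, integer powers of a non-zero `R`-algebraic real are `R`-algebraic. [standard] -/
theorem isAlgebraic_zpow_of_isAlgebraic' {R : Type*} [CommRing R] [NoZeroDivisors R] [Algebra R ℝ]
    {z : ℝ} (hz : z ≠ 0) (h : IsAlgebraic R z) (n : ℤ) : IsAlgebraic R (z ^ n) := by
  obtain ⟨m, rfl | rfl⟩ := Int.eq_nat_or_neg n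
  · rw [zpow_natCast]; exact h.pow m
  · rw [zpow_neg, zpow_natCast, ← inv_pow]; exact (isAlgebraic_inv_of_isAlgebraic hz h).pow m

/-- Over a domain `R`, if a NON-ZERO integer power of a non-zero real is `R`-algebraic then so is the real. [standard] -/
theorem isAlgebraic_of_zpow_isAlgebraic {R : Type*} [CommRing R] [NoZeroDivisors R] [Algebra R ℝ]
    {z : ℝ} (hz : z ≠ 0) {n : ℤ} (hn : n ≠ 0) (h : IsAlgebraic R (z ^ n)) : IsAlgebraic R z := by
  obtain ⟨m, rfl | rfl⟩ := Int.eq_nat_or_neg n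
  · rw [zpow_natCast] at h
    exact IsAlgebraic.of_pow (by omega) h
  · rw [zpow_neg, zpow_natCast] at h
    have h' : IsAlgebraic R (z ^ m) := by
      have := isAlgebraic_inv_of_isAlgebraic (inv_ne_zero (pow_ne_zero m hz)) h
      rwa [inv_inv] at this
    exact IsAlgebraic.of_pow (by omega) h'

/-- **Algebraic independence ⟹ multiplicative independence modulo `ℚ̄ˣ`.**  If `x, y ≠ 0` are algebraically
independent over `ℚ` then `x ^ a * y ^ b` is transcendental for every `(a, b) ≠ (0, 0)` in `ℤ²`.  (Proof: `x` is
transcendental over `R := ℚ[y]` (`AlgebraicIndependent.transcendental_adjoin`); if `x^a y^b = α ∈ ℚ̄` then `x^a = α·y^{-b}` is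
`R`-algebraic, hence so is `x` when `a ≠ 0`; when `a = 0`, `y^b ∈ ℚ̄` with `b ≠ 0` contradicts the transcendence of `y`.)
[standard; this node] -/
theorem transcendental_zpow_mul_zpow_of_algebraicIndependent {x y : ℝ} (hx : x ≠ 0) (hy : y ≠ 0)
    (h : AlgebraicIndependent ℚ ![x, y]) {a b : ℤ} (hab : a ≠ 0 ∨ b ≠ 0) :
    Transcendental ℚ (x ^ a * y ^ b) := by
  intro halg
  rcases eq_or_ne a 0 with rfl | ha
  · have hb : b ≠ 0 := by
      rcases hab with h0 | h0
      · exact absurd rfl h0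
      · exact h0
    rw [zpow_zero, one_mul] at halg
    have hyT : Transcendental ℚ y := by simpa using h.transcendental 1
    exact hyT (isAlgebraic_of_zpow_isAlgebraic hy hb halg)
  · have hxT : Transcendental (Algebra.adjoin ℚ ({y} : Set ℝ)) x := by
      have hs : (![x, y] '' ({1} : Set (Fin 2))) = ({y} : Set ℝ) := by
        ext z; simp
      have := h.transcendental_adjoin (s := ({1} : Set (Fin 2))) (i := 0) (by simp)
      rw [hs] at this
      simpa using this
    have hyR : y ∈ Algebra.adjoin ℚ ({y} : Set ℝ) := Algebra.subset_adjoin rfl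
    have hy_alg : IsAlgebraic (Algebra.adjoin ℚ ({y} : Set ℝ)) y :=
      isAlgebraic_algebraMap (⟨y, hyR⟩ : Algebra.adjoin ℚ ({y} : Set ℝ))
    have hα : IsAlgebraic (Algebra.adjoin ℚ ({y} : Set ℝ)) (x ^ a * y ^ b) :=
      halg.extendScalars (S := Algebra.adjoin ℚ ({y} : Set ℝ))
        (algebraMap ℚ (Algebra.adjoin ℚ ({y} : Set ℝ))).injective
    have hxa : IsAlgebraic (Algebra.adjoin ℚ ({y} : Set ℝ)) (x ^ a) := by
      have e : x ^ a = (x ^ a * y ^ b) * y ^ (-b) := by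
        rw [mul_assoc, ← zpow_add₀ hy, add_neg_cancel, zpow_zero, mul_one]
      rw [e]
      exact hα.mul (isAlgebraic_zpow_of_isAlgebraic' hy hy_alg (-b))
    exact hxT (isAlgebraic_of_zpow_isAlgebraic hx ha hxa)

/-- **CHUDNOVSKY 1976, typed faithfully**: `Γ(⅓)` and `π` are algebraically independent over `ℚ`
(cite Waldschmidt2006, Theorem 14; Chudnovsky 1976).  NAMED literature statement, unproved in the tree — a HYPOTHESIS here,
never a fact (candidate `Literature/NumberTheory/Transcendental/` named fact, verbatim). -/
def ChudnovskyGammaThird : Prop := AlgebraicIndependent ℚ ![Real.Gamma ((1:ℝ)/3), Real.pi]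

/-- **CHUDNOVSKY 1976, typed faithfully**: `Γ(¼)` and `π` are algebraically independent over `ℚ`
(cite Waldschmidt2006, Theorem 14; Chudnovsky 1976).  Hypothesis only, as above. -/
def ChudnovskyGammaQuarter : Prop := AlgebraicIndependent ℚ ![Real.Gamma ((1:ℝ)/4), Real.pi]

/-- Chudnovsky (faithful) ⟹ the multiplicative-independence hypothesis used at levels 3 and 6. [this node] -/
theorem gammaThirdPiIndep_of_chudnovsky (h : ChudnovskyGammaThird) : GammaThirdPiIndep :=
  fun _ _ hab => transcendental_zpow_mul_zpow_of_algebraicIndependent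
    (Real.Gamma_pos_of_pos (by norm_num)).ne' Real.pi_ne_zero h hab

/-- Chudnovsky (faithful) ⟹ the multiplicative-independence hypothesis used at level 4. [this node] -/
theorem gammaQuarterPiIndep_of_chudnovsky (h : ChudnovskyGammaQuarter) : GammaQuarterPiIndep :=
  fun _ _ hab => transcendental_zpow_mul_zpow_of_algebraicIndependent
    (Real.Gamma_pos_of_pos (by norm_num)).ne' Real.pi_ne_zero h hab

/-- Rohrlich's conjecture at level 3, from Chudnovsky's theorem as printed. [this node] -/
theorem rohrlichHodgeAt_three_of_chudnovsky (h : ChudnovskyGammaThird) : RohrlichHodgeAt 3 :=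
  rohrlichHodgeAt_three_of (gammaThirdPiIndep_of_chudnovsky h)

/-- Rohrlich's conjecture at level 4, from Chudnovsky's theorem as printed. [this node] -/
theorem rohrlichHodgeAt_four_of_chudnovsky (h : ChudnovskyGammaQuarter) : RohrlichHodgeAt 4 :=
  rohrlichHodgeAt_four_of (gammaQuarterPiIndep_of_chudnovsky h)

/-- Rohrlich's conjecture at level 6, from Chudnovsky's theorem as printed. [this node] -/
theorem rohrlichHodgeAt_six_of_chudnovsky (h : ChudnovskyGammaThird) : RohrlichHodgeAt 6 :=
  rohrlichHodgeAt_six_of (gammaThirdPiIndep_of_chudnovsky h)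

/-- **Levels 3 and 6 of every `k`-letter sector are their same-type chains, modulo Chudnovsky's theorem AS PRINTED.** -/
theorem betaWordSectorLevel_three_six_iff_of_chudnovsky (h : ChudnovskyGammaThird) (k : ℕ) :
    (BetaWordSectorLevel k 3 ↔ BoxChain k 3 (SameType 3)) ∧ (BetaWordSectorLevel k 6 ↔ BoxChain k 6 (SameType 6)) :=
  ⟨betaWordSectorLevel_three_iff (gammaThirdPiIndep_of_chudnovsky h) k,
   betaWordSectorLevel_six_iff (gammaThirdPiIndep_of_chudnovsky h) k⟩

/-- **Level 4 of every `k`-letter sector is its same-type chains, modulo Chudnovsky's theorem AS PRINTED.** -/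
theorem betaWordSectorLevel_four_iff_of_chudnovsky (h : ChudnovskyGammaQuarter) (k : ℕ) :
    BetaWordSectorLevel k 4 ↔ BoxChain k 4 (SameType 4) :=
  betaWordSectorLevel_four_iff (gammaQuarterPiIndep_of_chudnovsky h) k

/-- **The φ(N) ≤ 2 base range of crux 3898, in one line**: modulo the two printed Chudnovsky theorems, `BetaProductSector`
holds iff the level-2,3,4,6 boxes' same-type CHAINS hold and every level `N = 5` or `N ≥ 7` box holds. [this node] -/
theorem betaProductSector_iff_baseRange_of_chudnovsky (h3 : ChudnovskyGammaThird) (h4 : ChudnovskyGammaQuarter) :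
    Summit.KontsevichZagierPeriods.KontsevichZagierPeriods.Theses.FermatIsogeny.BetaProductSector ↔
      (BoxChain 2 3 (SameType 3) ∧ BoxChain 2 4 (SameType 4) ∧ BoxChain 2 6 (SameType 6)) ∧
      (∀ N, 3 ≤ N → N ≠ 3 → N ≠ 4 → N ≠ 6 → BetaWordSectorLevel 2 N) := by
  rw [betaProductSector_iff_levels_three_le]
  have e3 := (betaWordSectorLevel_three_six_iff_of_chudnovsky h3 2).1
  have e6 := (betaWordSectorLevel_three_six_iff_of_chudnovsky h3 2).2
  have e4 := betaWordSectorLevel_four_iff_of_chudnovsky h4 2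
  constructor
  · intro H
    exact ⟨⟨(e3.mp (H 3 le_rfl)), e4.mp (H 4 (by norm_num)), e6.mp (H 6 (by norm_num))⟩,
      fun N hN _ _ _ => H N hN⟩
  · rintro ⟨⟨c3, c4, c6⟩, H⟩ N hN
    by_cases h3' : N = 3
    · subst h3'; exact e3.mpr c3
    by_cases h4' : N = 4
    · subst h4'; exact e4.mpr c4
    by_cases h6' : N = 6
    · subst h6'; exact e6.mpr c6
    exact H N hN h3' h4' h6'

end ChudnovskyFaithful

end Summit.KontsevichZagierPeriods.FermatIsogeny.DeepTargets
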